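import Literature.MathematicalPhysics.QuantumFieldTheory.Balaban1983to89.B9Eq357QprimeTowerKernelForm
import Literature.MathematicalPhysics.QuantumFieldTheory.Balaban1983to89.B9Eq316PenaltyPointwiseBound
import Literature.MathematicalPhysics.QuantumFieldTheory.Balaban1983to89.B9Eq323SiteLaplacianJunction
import Literature.MathematicalPhysics.QuantumFieldTheory.Balaban1983to89.B9Eq360VprimeLetters

/-!
# `Balaban1983to89.B9Eq324PenaltyKernelForm` — T. Bałaban, *Propagators for lattice gauge theories in a background field*, Commun. Math. Phys.
# **99** (1985) 389–434 [Balaban1985BackgroundPropagators] (3.23)–(3.24) p. 394 with (3.19) p. 393 and (3.59)–(3.60) p. 402: **THE `k`-LEVEL SITE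
# OPERATOR `Δ′_{a′,k}(U) = Δ^η_U + a′Q̃′_k(U)†Q̃′_k(U)` OF THE NE9 CHAIN, READ IN `𝔸`, IS THE SECT. B PROGRAMME's `Δ_U + Q′*·a·Q′`** —
# `Q̃′_k(U)†` is the starred word `liftOp blkK s_Q` (`(Q′*ν)(x) = s_Q(x)ν(y_x)`), the penalty is `liftOp s_Q ∘ diagOp a′ ∘ kerOp k_Q`, the covariant
# Laplacian is r06's `siteLap` (by `B9Eq323SiteLaplacianJunction`); with the flat values `s_Q(1)(x) = (c₁∕(c₀L^{kd}))·1`, the sizes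
# `‖s_Q(U)(x)‖ ≤ M_φM_φ′·c₁∕(c₀L^{kd})` and the (3.59)-shaped letter of `s_F := s_Q(U) − s_Q(1)` — junction items (j2)∕(j3) of the NE9 lineage's route memo
# `ROUTE-J-VIA-THM34-g98.md` (the letters `kQ sQ kF sF cfun` and the operator `Δp` that `B9Thm34SectBUniform(R1).thm34_Gp_uniform` consumes)

statement-level skeleton of published theorems with citation tags; proofs where landed; nothing here is a claim about the Yang–Mills mass gap

CITATION HEADER (lean-in-tree rule).  Audit cell `pub-balaban`, sub-cell `t4`, BINDER row NE9; NE9 crux-team LEAF PROVER 01 (`b2b-balaban-t4-ne9-formalise-leaf-01`,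
gen 99; bears_on: R4/N22).  Vocabulary BY NAME: `B9Eq324DeltaPrimeATower.laplacePrimeAk` ((3.24) at `k = n+1` levels), `B9Eq326OperatorTower.QprimeTowerW`,
`B11Eq103H1Complex.covLaplaceSiteK` ∕ `SiteL2K`, `B9Eq311L2Pairing.WL2`, `B9Eq324PenaltyPointwiseBound.laplacePrimeAk_sub_covLaplace_eq` ∕ `inner_single_left` ∕
`norm_adjoint_apply_le` ∕ `norm_adjoint_QtildeTower_apply_le`, `B9Eq324PenaltyBlockLocal.adjoint_QtildeTower_apply_eq_of_eq_at`, `B9Eq316PenaltyPointwiseBound.norm_single_eq`,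
this lineage's `B9Eq357QprimeTowerKernelForm` (`blkK`, `kQ`, `kerOp_blkK_kQ_apply`, `kQ_flat_apply`, `kQ_eq_zero_of_ne`, `norm_kF_le`, `phi_QprimeTowerW_apply`) and
`B9Eq323SiteLaplacianJunction.phi_covLaplaceSiteK_eq_siteLap`, the Sect. B programme's `B9Eq360Vprime.kerOp` ∕ `liftOp` ∕ `diagOp` and `B9Eq360VprimeLetters.avgOp`
(cell `lit-balaban`, seat r06), `B9Eq352ScalarFluct.siteLap`.  Source read in the held text `paper:balaban1985-cmp99-background-propagators` (journal page = PDF page +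
388) through the verbatim quotations of those files: p. 394 (3.24) «Δ′_a = Δ_U + Q′*(U) a Q′(U)», p. 393 (3.19), p. 402 (3.59)–(3.60) «We have a similar expansion for the
adjoint operator … Δ_{U′U} + Q′*(U′U)aQ′(U′U) = … = Δ_U + Q′*(U)aQ′(U) − V′(A)».  [folklore] algebra between two encodings of the same printed operator; NOTHING of print's
estimates is asserted.

WHAT IS PROVED (sorry-free; two `def`s with bodies — the `𝔸`-reading `readA` of an operator of the chain's `L²` carrier and the starred kernel `sQ` — and theorems).
* §1 `readA φ T` (`Module.End ℝ (T_P → 𝔸)`: conjugation by the fibre identification `φ` and the carrier identification `WL2`), `readA_apply`, `readA_comp`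
  (multiplicative), `readA_add`, `readA_sub`, `readA_smul`, `readA_id`; **`readA_covLaplaceSiteK_apply`** (`= siteLap` — g98's junction BY NAME).
* §2 `sQ` (the starred kernel `s_Q(x) : 𝔸 →L[ℝ] 𝔸`, `s_Q(x)X := φ((Q̃′_k(U)†δ_{y_x}φ⁻¹X)(x))`), **`phi_adjoint_QtildeTower_apply`** (`φ((Q̃′_k(U)†h)(x)) = s_Q(x)(φ(h(y_x)))`:
  the adjoint is the starred word), **`readA_penalty_eq_word`** (`readA (Δ′_{a′,k}(U) − Δ^η_U) = liftOp blkK s_Q ∘ diagOp a′ ∘ kerOp blkK k_Q`),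
  **`readA_laplacePrimeAk_apply`** (`(readA Δ′_{a′,k}(U) f)(x) = siteLap f x + (liftOp s_Q (diagOp a′ (kerOp k_Q f)))(x)`).
* §3 FLAT VALUES AND SIZES: **`sQ_one_apply`** (`s_Q(1)(x)X = (c₁∕c₀)(L^{n+1})^{−d}·X` — `= X` on the diagonal `c₀(L^{n+1})^d = c₁`), `norm_sQ_one_le`,
  **`norm_sQ_le`** (`‖s_Q(U)(x)‖ ≤ M_φM_φ′(c₁∕c₀)(L^{n+1})^{−d}` for contractive level transporters), **`norm_sQ_sub_sQ_one_le`** (the (3.59)-shaped letter of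
  `s_F := s_Q(U) − s_Q(1)`: `≤ M_φM_φ′(c₁∕c₀)(Π_{j≤n}(1+ε_j)^{d(L−1)} − 1)(L^{n+1})^{−d}` from the level profile `ε_j` over the block — duality on `norm_kF_le`).
* §4 **`penWord_sub_penWord_eq_avgOp`** (`L[s_Q+s_F]·a·K[k_Q+k_F] − L[s_Q]·a·K[k_Q] = avgOp` — the bilinear expansion print performs in (3.60); the ten-line algebra of
  pub-ymgap's `B9Eq360DeltaPrimeAY.word_sub_word_eq_avgOp`, re-proved here to keep the NE9 chain free of the NODE 00 stack), **`readA_penalty_sub_penalty_eq_avgOp`**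
  (the penalties of `Δ′_{a′,k}(U)` and `Δ′_{a′,k}(V)` differ by r06's `avgOp blkK k_Q(V) (k_Q(U)−k_Q(V)) s_Q(V) (s_Q(U)−s_Q(V)) a′`).
HONEST SCOPE.  Bookkeeping of the chain's own (3.24) in the Sect. B programme's block vocabulary; the Laplacian law (3.53) at the flat base and the assembled (3.60) law for
`readA Δ′_{a′,k}` are the NEXT file; no estimate of the paper (the profile `ε_j` and `M_φ, M_φ′` are DISPLAYED); NE9 NOT PRINTED ∕ NOT PROVED; spine PROVED 0∕9; rung
(B)+1 finite T⁴ — NOT infinite volume, NOT mass gap, NOT BetaPertH, NOT Clay.  HONEST DEPENDENCY: continuum YM on T⁴ ⇐ BetaPertH ∧ nine spine estimates (0/9 proved); BetaPertH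
⇐ (D1) ∧ (D4) ∧ CAP+tail; G-an2-4 gates asym, D1 and NE2/3/4.  NEW file; nothing modified.  Net new unproved facts: 0.
-/

noncomputable section

open scoped BigOperators InnerProductSpace ComplexConjugate

namespace Literature.MathematicalPhysics.QuantumFieldTheory.Balaban1983to89.B9Eq324PenaltyKernelForm

open B4Sect5Torus (TSite)
open B9SectCLatticeCarrier (Bond shift)
open B9Eq319QprimeTorus (fineP blockCoord)
open B9Eq315QTower (towerP QprimeTower UlevOf)
open B9Eq311L2Pairing (WL2)
open B11Eq103H1Complex (SiteL2K covLaplaceSiteK)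
open B9Eq310HessianOperator (adTransportW)
open B9Eq33CovDerivVector (adTransport shiftEquiv)
open B9Eq326OperatorTower (QprimeTowerW)
open B9Eq324DeltaPrimeATower (laplacePrimeAk)
open B9Eq324PenaltyPointwiseBound (laplacePrimeAk_sub_covLaplace_eq inner_single_left norm_adjoint_apply_le norm_adjoint_QtildeTower_apply_le)
open B9Eq324PenaltyBlockLocal (adjoint_QtildeTower_apply_eq_of_eq_at)
open B9Eq316PenaltyPointwiseBound (norm_single_eq)
open B9Eq357QprimeTowerKernelForm (blkK blkK_eq_iff kQ kQ_apply kQ_flat_apply kQ_eq_zero_of_ne kerOp_blkK_kQ_apply norm_kF_le phi_QprimeTowerW_apply)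
open B9Eq360Vprime (kerOp kerOp_apply liftOp liftOp_apply diagOp diagOp_apply)
open B9Eq352ScalarFluct (siteLap)
open B9Eq323SiteLaplacianJunction (phi_covLaplaceSiteK_eq_siteLap)

/-! ## §1 Reading an operator of the chain's `L²` carrier as an `ℝ`-linear operator of `𝔸`-valued site functions -/

section ReadA

variable {d : ℕ} {P : Fin d → ℕ} {𝔸 : Type*} [NormedRing 𝔸] [NormedAlgebra ℂ 𝔸] {W : Type*} [NormedAddCommGroup W] [InnerProductSpace ℂ W]
  (φ : W ≃ₗ[ℂ] 𝔸) {c₀ : ℝ}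

/-- **The `𝔸`-reading of an operator of the `L²` gauge parameters**: conjugation by the carrier identification `WL2` and the fibre identification `φ`,
restricted to `ℝ` — the shape (`Module.End ℝ (S → 𝔸)`) in which the Sect. B programme takes its operators (`B9Eq352DivFormLetters.conj b` then realifies).
[cite: Balaban1985BackgroundPropagators, (3.11) p.392, (3.24) p.394] -/
def readA (T : SiteL2K ℂ d P c₀ W →ₗ[ℂ] SiteL2K ℂ d P c₀ W) : Module.End ℝ (TSite d P → 𝔸) :=
  (((WL2.linearEquiv ℂ ℂ (fun _ : TSite d P => c₀)).trans (LinearEquiv.piCongrRight fun _ : TSite d P => φ)).conj T).restrictScalars ℝ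

/-- Unfolding `readA`: `(readA T f)(x) = φ((T(φ⁻¹ ∘ f))(x))`. [cite: Balaban1985BackgroundPropagators, (3.11) p.392] -/
theorem readA_apply (T : SiteL2K ℂ d P c₀ W →ₗ[ℂ] SiteL2K ℂ d P c₀ W) (f : TSite d P → 𝔸) (x : TSite d P) :
    readA φ T f x = φ (WL2.equiv ℂ (fun _ : TSite d P => c₀) W (T ((WL2.equiv ℂ (fun _ : TSite d P => c₀) W).symm fun z => φ.symm (f z))) x) := rfl

/-- `readA` is multiplicative. [folklore] [cite: Balaban1985BackgroundPropagators, (3.24) p.394] -/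
theorem readA_comp (T₁ T₂ : SiteL2K ℂ d P c₀ W →ₗ[ℂ] SiteL2K ℂ d P c₀ W) : readA φ (T₁ ∘ₗ T₂) = readA φ T₁ * readA φ T₂ := by
  unfold readA
  rw [LinearEquiv.conj_comp]
  rfl

/-- `readA` is additive. [folklore] [cite: Balaban1985BackgroundPropagators, (3.24) p.394] -/
theorem readA_add (T₁ T₂ : SiteL2K ℂ d P c₀ W →ₗ[ℂ] SiteL2K ℂ d P c₀ W) : readA φ (T₁ + T₂) = readA φ T₁ + readA φ T₂ := by
  unfold readA
  rw [map_add]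
  rfl

/-- `readA` commutes with differences. [folklore] [cite: Balaban1985BackgroundPropagators, (3.24) p.394] -/
theorem readA_sub (T₁ T₂ : SiteL2K ℂ d P c₀ W →ₗ[ℂ] SiteL2K ℂ d P c₀ W) : readA φ (T₁ - T₂) = readA φ T₁ - readA φ T₂ := by
  unfold readA
  rw [map_sub]
  rfl

/-- `readA` commutes with real scalars. [folklore] [cite: Balaban1985BackgroundPropagators, (3.24) p.394] -/
theorem readA_smul (r : ℝ) (T : SiteL2K ℂ d P c₀ W →ₗ[ℂ] SiteL2K ℂ d P c₀ W) : readA φ ((r : ℂ) • T) = r • readA φ T := by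
  apply LinearMap.ext; intro f; funext x
  rw [readA_apply, LinearMap.smul_apply, WL2.equiv_smul, Pi.smul_apply, map_smul, Complex.coe_smul, LinearMap.smul_apply, Pi.smul_apply,
    readA_apply]

/-- `readA id = 1`. [folklore] [cite: Balaban1985BackgroundPropagators, (3.24) p.394] -/
theorem readA_id : readA φ (c₀ := c₀) (LinearMap.id : SiteL2K ℂ d P c₀ W →ₗ[ℂ] SiteL2K ℂ d P c₀ W) = 1 := by
  apply LinearMap.ext; intro f; funext x
  rw [readA_apply, LinearMap.id_apply, Equiv.apply_symm_apply, LinearEquiv.apply_symm_apply]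
  rfl

variable [Fact (0 < c₀)] (η : ℝ) (U : Bond d P → 𝔸ˣ)

/-- **THE COVARIANT LAPLACIAN READ IN `𝔸` IS r06's `siteLap`**: `(readA Δ^η_U f)(x) = siteLap T U η f x` at the dictionary `T μ := shiftEquiv μ`, `U μ x := U(x, μ)`
(`B9Eq323SiteLaplacianJunction.phi_covLaplaceSiteK_eq_siteLap` BY NAME). [cite: Balaban1985BackgroundPropagators, (3.23) p.394, (3.50) p.400] -/
theorem readA_covLaplaceSiteK_apply (f : TSite d P → 𝔸) (x : TSite d P) :
    readA φ (covLaplaceSiteK (c₀ := c₀) ((η : ℂ))⁻¹ (adTransportW φ U) (adTransportW φ fun b => (U b)⁻¹)) f x =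
      siteLap (fun μ => shiftEquiv (Pd := P) μ) (fun μ y => U (y, μ)) η f x := by
  rw [readA_apply, phi_covLaplaceSiteK_eq_siteLap]
  congr 1
  funext y
  rw [Equiv.apply_symm_apply, LinearEquiv.apply_symm_apply]

end ReadA

/-! ## §2 The starred kernel `s_Q` of `Q̃′_k(U)†` and the penalty as the word `liftOp s_Q ∘ diagOp a′ ∘ kerOp k_Q` -/

section Penalty

variable {d : ℕ} (L : ℕ) [NeZero L] (m : Fin d → ℕ) [∀ i, NeZero (m i)] (n : ℕ)
  {𝔸 : Type*} [NormedRing 𝔸] [NormedAlgebra ℂ 𝔸] [CompleteSpace 𝔸] [FiniteDimensional ℂ 𝔸]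
  {W : Type*} [NormedAddCommGroup W] [InnerProductSpace ℂ W] [FiniteDimensional ℂ W] (φ : W ≃ₗ[ℂ] 𝔸)
  {c₀ : ℝ} [Fact (0 < c₀)] {c₁ : ℝ} [Fact (0 < c₁)] (η : ℝ) (U : Bond d (towerP L m (n + 1)) → 𝔸ˣ) (a' : ℝ)

/-- **The starred kernel `s_Q(x) : 𝔸 →L[ℝ] 𝔸` of `Q̃′_k(U)†`** — `s_Q(x)X := φ((Q̃′_k(U)†(δ_{y_x}φ⁻¹X))(x))`, `y_x = blkK x`, `Q̃′_k(U)` the chain's composite read into the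
weight-`c₁` space (as inside `laplacePrimeAk`); print's `(Q′*(U)ν)(x) = R(U(Γ_{y,x}))*ν(y)` for `x ∈ Bʲ(y)`, in the shape r06's `liftOp` consumes.
[cite: Balaban1985BackgroundPropagators, (3.24) p.394, (3.19) p.393, (3.59) p.402] -/
def sQ (x : TSite d (towerP L m (n + 1))) : 𝔸 →L[ℝ] 𝔸 :=
  LinearMap.toContinuousLinearMap
    ((φ.toLinearMap ∘ₗ LinearMap.proj x ∘ₗ (WL2.linearEquiv ℂ ℂ (fun _ : TSite d (towerP L m (n + 1)) => c₀)).toLinearMap ∘ₗ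
        LinearMap.adjoint ((WL2.linearEquiv ℂ ℂ (fun _ : TSite d m => c₁)).symm.toLinearMap ∘ₗ QprimeTowerW L m n φ U (c₀ := c₀)) ∘ₗ
          (WL2.linearEquiv ℂ ℂ (fun _ : TSite d m => c₁)).symm.toLinearMap ∘ₗ
            LinearMap.single ℂ (fun _ : TSite d m => W) (blkK L m n x) ∘ₗ φ.symm.toLinearMap).restrictScalars ℝ)

/-- Unfolding `s_Q`. [cite: Balaban1985BackgroundPropagators, (3.24) p.394] -/
theorem sQ_apply (x : TSite d (towerP L m (n + 1))) (X : 𝔸) :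
    sQ L m n φ U (c₀ := c₀) (c₁ := c₁) x X =
      φ (WL2.equiv ℂ (fun _ : TSite d (towerP L m (n + 1)) => c₀) W
        (LinearMap.adjoint ((WL2.linearEquiv ℂ ℂ (fun _ : TSite d m => c₁)).symm.toLinearMap ∘ₗ QprimeTowerW L m n φ U (c₀ := c₀))
          ((WL2.equiv ℂ (fun _ : TSite d m => c₁) W).symm (Pi.single (blkK L m n x) (φ.symm X)))) x) := rfl

/-- **THE ADJOINT IS THE STARRED WORD: `φ((Q̃′_k(U)†h)(x)) = s_Q(x)(φ(h(y_x)))`** — `(Q̃′_k(U)†h)(x)` reads `h` at the big-block coordinate of `x` only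
(`B9Eq324PenaltyBlockLocal.adjoint_QtildeTower_apply_eq_of_eq_at`), linearly. [cite: Balaban1985BackgroundPropagators, (3.24) p.394, (3.59) p.402] -/
theorem phi_adjoint_QtildeTower_apply (h : SiteL2K ℂ d m c₁ W) (x : TSite d (towerP L m (n + 1))) :
    φ (WL2.equiv ℂ (fun _ : TSite d (towerP L m (n + 1)) => c₀) W
        (LinearMap.adjoint ((WL2.linearEquiv ℂ ℂ (fun _ : TSite d m => c₁)).symm.toLinearMap ∘ₗ QprimeTowerW L m n φ U (c₀ := c₀)) h) x) =
      sQ L m n φ U (c₀ := c₀) (c₁ := c₁) x (φ (WL2.equiv ℂ (fun _ : TSite d m => c₁) W h (blkK L m n x))) := by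
  rw [sQ_apply, LinearEquiv.symm_apply_apply]
  congr 2
  refine adjoint_QtildeTower_apply_eq_of_eq_at L m n φ U h _ x fun z hz => ?_
  rw [← (blkK_eq_iff L m n x z).2 hz, Equiv.apply_symm_apply, Pi.single_eq_same]

/-- The same as an identity of `𝔸`-valued site functions: `φ ∘ (Q̃′_k(U)†h) = liftOp blkK s_Q (φ ∘ h)`. [cite: Balaban1985BackgroundPropagators, (3.24) p.394] -/
theorem phi_adjoint_QtildeTower_eq_liftOp (h : SiteL2K ℂ d m c₁ W) :
    (fun x => φ (WL2.equiv ℂ (fun _ : TSite d (towerP L m (n + 1)) => c₀) W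
        (LinearMap.adjoint ((WL2.linearEquiv ℂ ℂ (fun _ : TSite d m => c₁)).symm.toLinearMap ∘ₗ QprimeTowerW L m n φ U (c₀ := c₀)) h) x)) =
      liftOp (blkK L m n) (sQ L m n φ U (c₀ := c₀) (c₁ := c₁)) (fun y => φ (WL2.equiv ℂ (fun _ : TSite d m => c₁) W h y)) := by
  funext x
  rw [phi_adjoint_QtildeTower_apply, liftOp_apply]

/-- **THE PENALTY OF `Δ′_{a′,k}(U)` READ IN `𝔸` IS THE WORD `liftOp s_Q ∘ diagOp a′ ∘ kerOp k_Q`** — print's `Q′*(U) a Q′(U)` of (3.24) in r06's block model, with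
`k_Q` the kernel of `B9Eq357QprimeTowerKernelForm` at the conjugations `R(Ū^j)` and the constant weight `a′` (one surviving level).
[cite: Balaban1985BackgroundPropagators, (3.24) p.394, (3.19) p.393] -/
theorem readA_penalty_eq_word :
    readA φ (laplacePrimeAk L m n φ η U a' (c₀ := c₀) (c₁ := c₁) -
        covLaplaceSiteK (c₀ := c₀) ((η : ℂ))⁻¹ (adTransportW φ U) (adTransportW φ fun b => (U b)⁻¹)) =
      liftOp (blkK L m n) (sQ L m n φ U (c₀ := c₀) (c₁ := c₁)) ∘ₗ diagOp (fun _ : TSite d m => a') ∘ₗ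
        kerOp (blkK L m n) (kQ L m n (fun j => adTransport (𝕜 := ℂ) (UlevOf L m (n + 1) U j))) := by
  apply LinearMap.ext; intro f; funext x
  rw [readA_apply, LinearMap.sub_apply, laplacePrimeAk_sub_covLaplace_eq, WL2.equiv_smul, Pi.smul_apply, map_smul, Complex.coe_smul,
    phi_adjoint_QtildeTower_apply]
  conv_rhs => rw [LinearMap.comp_apply, LinearMap.comp_apply, liftOp_apply, diagOp_apply, map_smul]
  congr 2
  rw [kerOp_blkK_kQ_apply, LinearMap.comp_apply, LinearEquiv.coe_coe, WL2.linearEquiv_symm_apply, Equiv.apply_symm_apply,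
    phi_QprimeTowerW_apply]
  have hf : (fun z => φ (WL2.equiv ℂ (fun _ : TSite d (towerP L m (n + 1)) => c₀) W
      ((WL2.equiv ℂ (fun _ : TSite d (towerP L m (n + 1)) => c₀) W).symm fun z => φ.symm (f z)) z)) = f := by
    funext z
    rw [Equiv.apply_symm_apply, LinearEquiv.apply_symm_apply]
  rw [hf]

/-- **(3.24) AT `k` LEVELS, READ IN `𝔸`: `(readA Δ′_{a′,k}(U) f)(x) = siteLap T U η f x + (liftOp s_Q (diagOp a′ (kerOp k_Q f)))(x)`** — the chain's site operator IS
the Sect. B programme's `Δ_U + Q′*(U)aQ′(U)`. [cite: Balaban1985BackgroundPropagators, (3.23)–(3.24) p.394] -/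
theorem readA_laplacePrimeAk_apply (f : TSite d (towerP L m (n + 1)) → 𝔸) (x : TSite d (towerP L m (n + 1))) :
    readA φ (laplacePrimeAk L m n φ η U a' (c₀ := c₀) (c₁ := c₁)) f x =
      siteLap (fun μ => shiftEquiv (Pd := towerP L m (n + 1)) μ) (fun μ y => U (y, μ)) η f x +
        liftOp (blkK L m n) (sQ L m n φ U (c₀ := c₀) (c₁ := c₁)) (diagOp (fun _ : TSite d m => a')
          (kerOp (blkK L m n) (kQ L m n (fun j => adTransport (𝕜 := ℂ) (UlevOf L m (n + 1) U j))) f)) x := by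
  have h := readA_penalty_eq_word L m n φ η U a' (c₀ := c₀) (c₁ := c₁)
  rw [readA_sub, sub_eq_iff_eq_add] at h
  rw [h, LinearMap.add_apply, Pi.add_apply, readA_covLaplaceSiteK_apply, add_comm]
  rfl

end Penalty

/-! ## §3 Flat values and sizes of `s_Q` -/

section Sizes

variable {d : ℕ} (L : ℕ) [NeZero L] (m : Fin d → ℕ) [∀ i, NeZero (m i)] (n : ℕ)
  {𝔸 : Type*} [NormedRing 𝔸] [NormedAlgebra ℂ 𝔸] [CompleteSpace 𝔸] [FiniteDimensional ℂ 𝔸]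
  {W : Type*} [NormedAddCommGroup W] [InnerProductSpace ℂ W] [FiniteDimensional ℂ W] (φ : W ≃ₗ[ℂ] 𝔸)
  {c₀ : ℝ} [Fact (0 < c₀)] {c₁ : ℝ} [Fact (0 < c₁)]

/-- **THE FLAT STARRED KERNEL: `s_Q(1)(x)X = (c₁∕c₀)(L^{n+1})^{−d}·X`** (`= X` on the diagonal `c₀(L^{n+1})^d = c₁`) — duality against the flat kernel
`k_Q(1)(y, x) = (L^{n+1})^{−d}` (`c₀⟨u, (Q̃′†δ_y w)(x)⟩ = c₁⟨(Q̃′δ_x u)(y), w⟩`). [cite: Balaban1985BackgroundPropagators, (3.24) p.394, (3.19) p.393, (3.11) p.392] -/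
theorem sQ_one_apply (x : TSite d (towerP L m (n + 1))) (X : 𝔸) :
    sQ L m n φ (fun _ : Bond d (towerP L m (n + 1)) => (1 : 𝔸ˣ)) (c₀ := c₀) (c₁ := c₁) x X = ((c₁ / c₀) * (((L : ℝ) ^ (n + 1)) ^ d)⁻¹) • X := by
  have hc₀ : 0 < c₀ := Fact.out
  rw [sQ_apply]
  set A := (WL2.linearEquiv ℂ ℂ (fun _ : TSite d m => c₁)).symm.toLinearMap ∘ₗ
    QprimeTowerW L m n φ (fun _ : Bond d (towerP L m (n + 1)) => (1 : 𝔸ˣ)) (c₀ := c₀) with hA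
  set w : W := φ.symm X with hw
  -- the value of `Q̃′_k(1)†(δ_y w)` at `x`, by duality
  have key : WL2.equiv ℂ (fun _ : TSite d (towerP L m (n + 1)) => c₀) W
      (LinearMap.adjoint A ((WL2.equiv ℂ (fun _ : TSite d m => c₁) W).symm (Pi.single (blkK L m n x) w))) x =
        (((c₁ / c₀) * (((L : ℝ) ^ (n + 1)) ^ d)⁻¹ : ℝ) : ℂ) • w := by
    refine ext_inner_left ℂ fun u => ?_
    have hwx : (RCLike.ofReal ((fun _ : TSite d (towerP L m (n + 1)) => c₀) x) : ℂ) ≠ 0 := by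
      rw [Ne, RCLike.ofReal_eq_zero]; exact hc₀.ne'
    refine mul_left_cancel₀ hwx ?_
    rw [← inner_single_left (𝕜 := ℂ) (w := fun _ : TSite d (towerP L m (n + 1)) => c₀) x u, LinearMap.adjoint_inner_right,
      ← inner_conj_symm, inner_single_left (𝕜 := ℂ) (w := fun _ : TSite d m => c₁), map_mul, RCLike.conj_ofReal, inner_conj_symm]
    -- `(Q̃′_k(1)δ_x u)(y_x) = (L^{n+1})^{−d}·u`
    have hflat : WL2.equiv ℂ (fun _ : TSite d m => c₁) W (A ((WL2.equiv ℂ (fun _ : TSite d (towerP L m (n + 1)) => c₀) W).symm (Pi.single x u)))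
        (blkK L m n x) = ((((L : ℝ) ^ (n + 1)) ^ d)⁻¹ : ℝ) • u := by
      rw [hA, LinearMap.comp_apply, LinearEquiv.coe_coe, WL2.linearEquiv_symm_apply, Equiv.apply_symm_apply]
      have h1 := kQ_flat_apply L m n (V := W) (x := x) (y := blkK L m n x) rfl u
      rw [kQ_apply] at h1
      rw [← h1]
      have hone : (fun j => adTransportW φ (UlevOf L m (n + 1) (fun _ : Bond d (towerP L m (n + 1)) => (1 : 𝔸ˣ)) j)) =
          fun _ _ => (LinearMap.id : W →ₗ[ℂ] W) := by
        funext j b; rw [B9Eq315QTowerFlat.UlevOf_one, B5Eq172HodgePositivity.adTransportW_one]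
      unfold QprimeTowerW
      rw [LinearMap.comp_apply, LinearEquiv.coe_coe, WL2.linearEquiv_apply, Equiv.apply_symm_apply, hone]
    rw [hflat, ← Complex.coe_smul, inner_smul_left, inner_smul_right, Complex.conj_ofReal]
    have hc₀' : (c₀ : ℂ) ≠ 0 := by exact_mod_cast hc₀.ne'
    have hL' : ((L : ℂ) ^ (n + 1)) ^ d ≠ 0 := pow_ne_zero _ (pow_ne_zero _ (by exact_mod_cast NeZero.ne L))
    show (c₁ : ℂ) * _ = (c₀ : ℂ) * _
    simp only [Complex.ofReal_mul, Complex.ofReal_div, Complex.ofReal_inv, Complex.ofReal_pow, Complex.ofReal_natCast]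
    field_simp
  rw [key, map_smul, Complex.coe_smul, hw, LinearEquiv.apply_symm_apply]

/-- **r06's `hsQ` AT THE FLAT BASE: `‖s_Q(1)(x)‖ ≤ (c₁∕c₀)(L^{n+1})^{−d}`** (`≤ 1` on the diagonal). [cite: Balaban1985BackgroundPropagators, (3.24) p.394] -/
theorem norm_sQ_one_le (x : TSite d (towerP L m (n + 1))) :
    ‖sQ L m n φ (fun _ : Bond d (towerP L m (n + 1)) => (1 : 𝔸ˣ)) (c₀ := c₀) (c₁ := c₁) x‖ ≤ (c₁ / c₀) * (((L : ℝ) ^ (n + 1)) ^ d)⁻¹ := by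
  have hc₀ : 0 < c₀ := Fact.out
  have hc₁ : 0 < c₁ := Fact.out
  refine ContinuousLinearMap.opNorm_le_bound _ (by positivity) fun X => ?_
  rw [sQ_one_apply, norm_smul, Real.norm_of_nonneg (by positivity)]

variable (U : Bond d (towerP L m (n + 1)) → 𝔸ˣ) {Mφ Mφ' : ℝ} (hMφ : 0 ≤ Mφ) (hMφ' : 0 ≤ Mφ') (hφ : ∀ w, ‖φ w‖ ≤ Mφ * ‖w‖)
  (hφ' : ∀ X, ‖φ.symm X‖ ≤ Mφ' * ‖X‖)

include hMφ hMφ' hφ hφ' in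
/-- **THE SIZE OF THE STARRED KERNEL: `‖s_Q(U)(x)‖ ≤ M_φM_φ′(c₁∕c₀)(L^{n+1})^{−d}`** for contractive level transporters (`B9Eq324PenaltyPointwiseBound.norm_adjoint_QtildeTower_apply_le`
at the one-site function, `‖δ_y w‖_{c₁} = √c₁‖w‖`); r06's `hsQ : ‖sQ x‖ ≤ 1` after the rescaling `(s_Q, a′) ↦ (s_Q∕σ, σa′)`, `σ := M_φM_φ′c₁∕(c₀L^{kd})`, if wanted.
[cite: Balaban1985BackgroundPropagators, (3.24) p.394, (3.19) p.393, (3.11) p.392] -/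
theorem norm_sQ_le (hRlev : ∀ j b w, ‖adTransportW φ (UlevOf L m (n + 1) U j) b w‖ ≤ ‖w‖) (x : TSite d (towerP L m (n + 1))) :
    ‖sQ L m n φ U (c₀ := c₀) (c₁ := c₁) x‖ ≤ Mφ * Mφ' * ((c₁ / c₀) * (((L : ℝ) ^ (n + 1)) ^ d)⁻¹) := by
  have hc₀ : 0 < c₀ := Fact.out
  have hc₁ : 0 < c₁ := Fact.out
  refine ContinuousLinearMap.opNorm_le_bound _ (by positivity) fun X => ?_
  rw [sQ_apply]
  refine (hφ _).trans ?_
  have h1 := norm_adjoint_QtildeTower_apply_le L m n φ U hRlev (c₀ := c₀) (c₁ := c₁)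
    ((WL2.equiv ℂ (fun _ : TSite d m => c₁) W).symm (Pi.single (blkK L m n x) (φ.symm X))) x
  rw [norm_single_eq] at h1
  have h2 : ‖φ.symm X‖ ≤ Mφ' * ‖X‖ := hφ' X
  calc Mφ * ‖WL2.equiv ℂ (fun _ : TSite d (towerP L m (n + 1)) => c₀) W
          (LinearMap.adjoint ((WL2.linearEquiv ℂ ℂ (fun _ : TSite d m => c₁)).symm.toLinearMap ∘ₗ QprimeTowerW L m n φ U (c₀ := c₀))
            ((WL2.equiv ℂ (fun _ : TSite d m => c₁) W).symm (Pi.single (blkK L m n x) (φ.symm X)))) x‖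
      ≤ Mφ * (Real.sqrt c₁ * (((L : ℝ) ^ (n + 1)) ^ d)⁻¹ / c₀ * (Real.sqrt c₁ * ‖φ.symm X‖)) := mul_le_mul_of_nonneg_left h1 hMφ
    _ ≤ Mφ * (Real.sqrt c₁ * (((L : ℝ) ^ (n + 1)) ^ d)⁻¹ / c₀ * (Real.sqrt c₁ * (Mφ' * ‖X‖))) := by gcongr
    _ = Mφ * Mφ' * ((Real.sqrt c₁ * Real.sqrt c₁ / c₀) * (((L : ℝ) ^ (n + 1)) ^ d)⁻¹) * ‖X‖ := by ring
    _ = Mφ * Mφ' * ((c₁ / c₀) * (((L : ℝ) ^ (n + 1)) ^ d)⁻¹) * ‖X‖ := by rw [Real.mul_self_sqrt hc₁.le]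

include hMφ hMφ' hφ hφ' in
/-- **THE (3.59)-SHAPED LETTER OF `s_F := s_Q(U) − s_Q(1)`**: `‖s_Q(U)(x) − s_Q(1)(x)‖ ≤ M_φM_φ′(c₁∕c₀)(Π_{j≤n}(1+ε_j)^{d(L−1)} − 1)(L^{n+1})^{−d}` whenever, for
every level `j ≤ n`, the `W`-transporters of the level-`(j+1)` bonds internal to a level-`j` block over `y_x` are `ε_j`-close to the identity — duality
(`norm_adjoint_apply_le`) on the one-site image of `Q̃′_k(U) − Q̃′_k(1)`, which is `δ_{y_x}` of the kernel difference `k_F(y_x, x)u` (`norm_kF_le`); r06's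
`hsF : ‖sF x‖ ≤ C_qα₁` («We denote operators in this expansion by adding a star», (3.59)). [cite: Balaban1985BackgroundPropagators, (3.58)–(3.59) p.402, (3.24) p.394] -/
theorem norm_sQ_sub_sQ_one_le (ε : ℕ → ℝ) (hε : ∀ j, 0 ≤ ε j) (x : TSite d (towerP L m (n + 1)))
    (hR : ∀ j < n + 1, ∀ (z : TSite d (towerP L m (j + 1))) (μ : Fin d),
        blockCoord L (towerP L m j) z = blockCoord L (towerP L m j) (shift μ z) → (∀ i, (z i : ℕ) / L ^ (j + 1) = ((blkK L m n x) i : ℕ)) →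
          ∀ w, ‖adTransportW φ (UlevOf L m (n + 1) U j) (z, μ) w - w‖ ≤ ε j * ‖w‖) :
    ‖sQ L m n φ U (c₀ := c₀) (c₁ := c₁) x - sQ L m n φ (fun _ : Bond d (towerP L m (n + 1)) => (1 : 𝔸ˣ)) (c₀ := c₀) (c₁ := c₁) x‖ ≤
      Mφ * Mφ' * ((c₁ / c₀) * (((∏ j ∈ Finset.range (n + 1), (1 + ε j) ^ (d * (L - 1))) - 1) * (((L : ℝ) ^ (n + 1)) ^ d)⁻¹)) := by
  have hc₀ : 0 < c₀ := Fact.out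
  have hc₁ : 0 < c₁ := Fact.out
  have hPr : 1 ≤ ∏ j ∈ Finset.range (n + 1), (1 + ε j) ^ (d * (L - 1)) :=
    Finset.one_le_prod (s := Finset.range (n + 1)) fun j _ => one_le_pow₀ (by linarith [hε j])
  have hρ : 0 ≤ (∏ j ∈ Finset.range (n + 1), (1 + ε j) ^ (d * (L - 1))) - 1 := by linarith
  -- names: the two `Q̃′`s and their difference
  set AU := (WL2.linearEquiv ℂ ℂ (fun _ : TSite d m => c₁)).symm.toLinearMap ∘ₗ QprimeTowerW L m n φ U (c₀ := c₀) with hAU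
  set A1 := (WL2.linearEquiv ℂ ℂ (fun _ : TSite d m => c₁)).symm.toLinearMap ∘ₗ
    QprimeTowerW L m n φ (fun _ : Bond d (towerP L m (n + 1)) => (1 : 𝔸ˣ)) (c₀ := c₀) with hA1
  set y := blkK L m n x with hy
  -- the one-site image of the difference is `δ_y (k_F(y, x) u)`
  have himg : ∀ u : W, (AU - A1) ((WL2.equiv ℂ (fun _ : TSite d (towerP L m (n + 1)) => c₀) W).symm (Pi.single x u)) =
      (WL2.equiv ℂ (fun _ : TSite d m => c₁) W).symm (Pi.single y
        ((kQ L m n (fun j => adTransportW φ (UlevOf L m (n + 1) U j)) -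
          kQ L m n (fun _ _ => (LinearMap.id : W →ₗ[ℂ] W))) y x u)) := by
    intro u
    apply (WL2.equiv ℂ (fun _ : TSite d m => c₁) W).injective
    funext z
    rw [Equiv.apply_symm_apply, LinearMap.sub_apply, WL2.equiv_sub, Pi.sub_apply, hAU, hA1]
    simp only [LinearMap.comp_apply, LinearEquiv.coe_coe, WL2.linearEquiv_symm_apply, Equiv.apply_symm_apply]
    have eU : QprimeTowerW L m n φ U (c₀ := c₀) ((WL2.equiv ℂ (fun _ : TSite d (towerP L m (n + 1)) => c₀) W).symm (Pi.single x u)) z =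
        kQ L m n (fun j => adTransportW φ (UlevOf L m (n + 1) U j)) z x u := by
      rw [kQ_apply]; rfl
    have e1 : QprimeTowerW L m n φ (fun _ : Bond d (towerP L m (n + 1)) => (1 : 𝔸ˣ)) (c₀ := c₀)
        ((WL2.equiv ℂ (fun _ : TSite d (towerP L m (n + 1)) => c₀) W).symm (Pi.single x u)) z =
        kQ L m n (fun _ _ => (LinearMap.id : W →ₗ[ℂ] W)) z x u := by
      rw [kQ_apply]
      have hone : (fun j => adTransportW φ (UlevOf L m (n + 1) (fun _ : Bond d (towerP L m (n + 1)) => (1 : 𝔸ˣ)) j)) =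
          fun _ _ => (LinearMap.id : W →ₗ[ℂ] W) := by
        funext j b; rw [B9Eq315QTowerFlat.UlevOf_one, B5Eq172HodgePositivity.adTransportW_one]
      unfold QprimeTowerW
      rw [LinearMap.comp_apply, LinearEquiv.coe_coe, WL2.linearEquiv_apply, Equiv.apply_symm_apply, hone]
    rw [eU, e1]
    by_cases hz : z = y
    · rw [hz, Pi.single_eq_same, Pi.sub_apply, Pi.sub_apply, sub_apply]
    · have hne : blkK L m n x ≠ z := fun h => hz (h.symm.trans hy.symm)
      rw [Pi.single_eq_of_ne hz, kQ_eq_zero_of_ne L m n _ hne, kQ_eq_zero_of_ne L m n _ hne]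
      simp
  -- hence its `c₁`-norm is `√c₁‖k_F(y,x)u‖ ≤ √c₁·ρ·(L^{n+1})^{−d}‖u‖`
  have hkF := norm_kF_le L m n (fun j => adTransportW φ (UlevOf L m (n + 1) U j)) ε hε y hR x
  have h1site : ∀ u : W, ‖(AU - A1) ((WL2.equiv ℂ (fun _ : TSite d (towerP L m (n + 1)) => c₀) W).symm (Pi.single x u))‖ ≤
      Real.sqrt c₁ * (((∏ j ∈ Finset.range (n + 1), (1 + ε j) ^ (d * (L - 1))) - 1) * (((L : ℝ) ^ (n + 1)) ^ d)⁻¹) * ‖u‖ := by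
    intro u
    rw [himg, norm_single_eq, mul_assoc]
    refine mul_le_mul_of_nonneg_left ?_ (Real.sqrt_nonneg _)
    exact (ContinuousLinearMap.le_opNorm _ u).trans (mul_le_mul_of_nonneg_right hkF (norm_nonneg _))
  -- duality
  have hdual := norm_adjoint_apply_le (𝕜 := ℂ) (w := fun _ : TSite d (towerP L m (n + 1)) => c₀) (AU - A1) x (by positivity) h1site
  refine ContinuousLinearMap.opNorm_le_bound _ (by positivity) fun X => ?_
  rw [sub_apply, sQ_apply, sQ_apply, ← hAU, ← hA1, ← hy, ← map_sub, ← Pi.sub_apply, ← WL2.equiv_sub, ← LinearMap.sub_apply,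
    ← map_sub]
  refine (hφ _).trans ?_
  have h2 := hdual ((WL2.equiv ℂ (fun _ : TSite d m => c₁) W).symm (Pi.single y (φ.symm X)))
  rw [norm_single_eq] at h2
  have h3 : ‖φ.symm X‖ ≤ Mφ' * ‖X‖ := hφ' X
  calc Mφ * ‖WL2.equiv ℂ (fun _ : TSite d (towerP L m (n + 1)) => c₀) W (LinearMap.adjoint (AU - A1)
          ((WL2.equiv ℂ (fun _ : TSite d m => c₁) W).symm (Pi.single y (φ.symm X)))) x‖
      ≤ Mφ * (Real.sqrt c₁ * (((∏ j ∈ Finset.range (n + 1), (1 + ε j) ^ (d * (L - 1))) - 1) * (((L : ℝ) ^ (n + 1)) ^ d)⁻¹) / c₀ *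
          (Real.sqrt c₁ * ‖φ.symm X‖)) := mul_le_mul_of_nonneg_left h2 hMφ
    _ ≤ Mφ * (Real.sqrt c₁ * (((∏ j ∈ Finset.range (n + 1), (1 + ε j) ^ (d * (L - 1))) - 1) * (((L : ℝ) ^ (n + 1)) ^ d)⁻¹) / c₀ *
          (Real.sqrt c₁ * (Mφ' * ‖X‖))) := by gcongr
    _ = Mφ * Mφ' * ((Real.sqrt c₁ * Real.sqrt c₁ / c₀) * (((∏ j ∈ Finset.range (n + 1), (1 + ε j) ^ (d * (L - 1))) - 1) *
          (((L : ℝ) ^ (n + 1)) ^ d)⁻¹)) * ‖X‖ := by ring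
    _ = Mφ * Mφ' * ((c₁ / c₀) * (((∏ j ∈ Finset.range (n + 1), (1 + ε j) ^ (d * (L - 1))) - 1) * (((L : ℝ) ^ (n + 1)) ^ d)⁻¹)) * ‖X‖ := by
        rw [Real.mul_self_sqrt hc₁.le]

end Sizes

/-! ## §4 The bilinear expansion behind (3.60): the penalties at two backgrounds differ by r06's `avgOp` -/

section AvgOp

variable {X 𝔅 : Type*} [Fintype X] [DecidableEq 𝔅] {E : Type*} [NormedAddCommGroup E] [NormedSpace ℝ E]

/-- **`L[s_Q + s_F]·a·K[k_Q + k_F] − L[s_Q]·a·K[k_Q] = avgOp blk k_Q k_F s_Q s_F c`** — print's «Combining (3.53) and (3.59) we get …» expansion in r06's block model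
(the identity of pub-ymgap's `B9Eq360DeltaPrimeAY.word_sub_word_eq_avgOp`, re-proved here so that the NE9 chain does not import the NODE 00 stack).
[cite: Balaban1985BackgroundPropagators, (3.60) p.402] -/
theorem penWord_sub_penWord_eq_avgOp (blk : X → 𝔅) (kQ kF : 𝔅 → X → E →L[ℝ] E) (sQ sF : X → E →L[ℝ] E) (c : 𝔅 → ℝ) :
    liftOp blk (sQ + sF) ∘ₗ diagOp c ∘ₗ kerOp blk (kQ + kF) - liftOp blk sQ ∘ₗ diagOp c ∘ₗ kerOp blk kQ =
      B9Eq360VprimeLetters.avgOp blk kQ kF sQ sF c := by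
  apply LinearMap.ext; intro μ; funext x
  simp only [LinearMap.sub_apply, LinearMap.comp_apply, Pi.sub_apply, B9Eq360VprimeLetters.avgOp_apply, liftOp_apply, diagOp_apply,
    kerOp_apply, Pi.add_apply, add_apply, Finset.sum_add_distrib, smul_add, map_add]
  abel

end AvgOp

section TwoBackgrounds

variable {d : ℕ} (L : ℕ) [NeZero L] (m : Fin d → ℕ) [∀ i, NeZero (m i)] (n : ℕ)
  {𝔸 : Type*} [NormedRing 𝔸] [NormedAlgebra ℂ 𝔸] [CompleteSpace 𝔸] [FiniteDimensional ℂ 𝔸]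
  {W : Type*} [NormedAddCommGroup W] [InnerProductSpace ℂ W] [FiniteDimensional ℂ W] (φ : W ≃ₗ[ℂ] 𝔸)
  {c₀ : ℝ} [Fact (0 < c₀)] {c₁ : ℝ} [Fact (0 < c₁)] (η : ℝ) (U V : Bond d (towerP L m (n + 1)) → 𝔸ˣ) (a' : ℝ)

/-- **THE PENALTIES OF `Δ′_{a′,k}(U)` AND `Δ′_{a′,k}(V)` DIFFER BY r06's `avgOp`** with `kQ := k_Q(V)`, `kF := k_Q(U) − k_Q(V)`, `sQ := s_Q(V)`, `sF := s_Q(U) − s_Q(V)`,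
`c ≡ a′`: `readA(Δ′_{a′,k}(U) − Δ^η_U) − readA(Δ′_{a′,k}(V) − Δ^η_V) = avgOp blkK kQ kF sQ sF a′` — the averaging half of (3.60) for the chain (base `V`, typically `V = 1`).
[cite: Balaban1985BackgroundPropagators, (3.59)–(3.60) p.402, (3.24) p.394] -/
theorem readA_penalty_sub_penalty_eq_avgOp :
    readA φ (laplacePrimeAk L m n φ η U a' (c₀ := c₀) (c₁ := c₁) - covLaplaceSiteK (c₀ := c₀) ((η : ℂ))⁻¹ (adTransportW φ U) (adTransportW φ fun b => (U b)⁻¹)) -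
      readA φ (laplacePrimeAk L m n φ η V a' (c₀ := c₀) (c₁ := c₁) - covLaplaceSiteK (c₀ := c₀) ((η : ℂ))⁻¹ (adTransportW φ V) (adTransportW φ fun b => (V b)⁻¹)) =
      B9Eq360VprimeLetters.avgOp (blkK L m n) (kQ L m n (fun j => adTransport (𝕜 := ℂ) (UlevOf L m (n + 1) V j)))
        (kQ L m n (fun j => adTransport (𝕜 := ℂ) (UlevOf L m (n + 1) U j)) - kQ L m n (fun j => adTransport (𝕜 := ℂ) (UlevOf L m (n + 1) V j)))
        (sQ L m n φ V (c₀ := c₀) (c₁ := c₁)) (sQ L m n φ U (c₀ := c₀) (c₁ := c₁) - sQ L m n φ V (c₀ := c₀) (c₁ := c₁)) (fun _ : TSite d m => a') := by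
  rw [readA_penalty_eq_word, readA_penalty_eq_word, ← penWord_sub_penWord_eq_avgOp, add_sub_cancel, add_sub_cancel]

end TwoBackgrounds

end Literature.MathematicalPhysics.QuantumFieldTheory.Balaban1983to89.B9Eq324PenaltyKernelForm

end
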